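import Mathlib
import HarnessLib

/-!
# The reference flow time `t₀` read by LINEAR INTERPOLATION between flow steps: the crossing exists and is unique on a monotone step, the interpolated time lies in the step, and its error is second order in the step — `≤ (M/m)·h²/8` under a slope floor `m` and a two-sided curvature bound `M`

HONEST FRAMING: exact (Metropolis-corrected) sampling algorithms for lattice gauge theory;
figures of merit are autocorrelation/cost numbers at stated couplings and volumes; no
continuum-physics claim.

Venture `LatticeQCDFlow` (cell pub-lqcd), sub-topic `Scoring`, FANOUT row 21 (`su3-base`).  The row's measurement
protocol (HOME/su3-base/CARD-su3-base.md §3, "EXACTNESS SUBSET") integrates the Wilson flow with Lüscher's RK3 at a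
step `h = 0.02` for `t ≤ 1` and `h = 0.05` beyond, records the flowed clover energy at every step, and reads the
reference scale "`t₀/a²` from `t² E_clov = 0.3` (LINEAR INTERPOLATION between steps)"; acceptance test (d) then compares
`t₀/a²` with an interpolated literature value inside a `3 %` band.  The interpolation is a source of systematic error of
the READING (not of the sampler) that the band must absorb.  This file is the elementary real analysis of that reading —
OUR WORK over Mathlib (`intermediate_value_Icc`, `ConvexOn.secant_mono_aux1`), no definition introduced, nothing cited as
a fact, no number of ours.  Throughout `g : ℝ → ℝ` is the profile along which the crossing is read (one configuration's
`t ↦ t²E(t)`, or an ensemble mean), `a < b` two consecutive flow times (`b − a = h`), `c` the target (`0.3`), the CHORD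
is `x ↦ g a + (x − a)·(g b − g a)/(b − a)` and the INTERPOLATED TIME is `t⋆ = a + (c − g a)(b − a)/(g b − g a)`.

* §1 `flowScale_existsUnique_root` — `g` continuous and strictly increasing on `[a, b]` with `g a ≤ c ≤ g b`: the crossing
  `t₀ ∈ [a, b]`, `g t₀ = c`, EXISTS and is UNIQUE (the reading is well posed on the bracketing step; nothing is said about
  steps where the profile is not monotone — there the code's "first bracketing step" is a convention, not a theorem).
* §2 `linInterp_sub_left`, **`linInterp_mem_Icc`** (`a ≤ t⋆ ≤ b`), `chord_linInterp` (the chord takes the value `c` at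
  `t⋆`), `linInterp_eq_root_of_affine` (exact on affine profiles).
* §3 **`abs_linInterp_sub_root_le_step`** — THE WORST CASE, hypothesis-free: `|t⋆ − t₀| ≤ b − a = h` (both lie in the
  step).  `abs_sub_le_abs_sub_div_of_slopeFloor` — a SLOPE FLOOR `m > 0` (`m(y − x) ≤ g y − g x` on the step) converts
  an ordinate residual into a time error: `|t − t₀| ≤ |g t − c|/m`; in particular `|t⋆ − t₀| ≤ |g t⋆ − chord t⋆|/m` —
  the error of the reading is the CHORD ERROR at `t⋆` over the slope.
* §4 THE CHORD ERROR WITHOUT DERIVATIVES: if `x ↦ g x + (M/2)x²` is convex on `[a, b]` then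
  `g x − chord x ≤ (M/2)(x − a)(b − x)` (**`sub_chord_le_of_convexOn`**); if `x ↦ g x − (M/2)x²` is concave then
  `chord x − g x ≤ (M/2)(x − a)(b − x)` (**`chord_sub_le_of_concaveOn`**); `(x − a)(b − x) ≤ (b − a)²/4`; hence
  **`abs_sub_chord_le`** — `|g x − chord x| ≤ M(b − a)²/8` (the classical `‖g''‖∞ h²/8`, stated with the weak two-sided
  curvature hypothesis so that no differentiability is assumed).
* §5 **`abs_linInterp_sub_root_le_of_curvature`** — THE BOUND: slope floor `m > 0` and two-sided curvature `M ≥ 0` on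
  the step give `|t⋆ − t₀| ≤ M(b − a)²/(8m)` — SECOND ORDER in the flow step.  ONE-SIDED CERTIFICATES:
  **`linInterp_le_root_of_convexOn`** (convex increasing profile on the step ⇒ `t⋆ ≤ t₀`: the reading UNDER-estimates)
  and **`root_le_linInterp_of_concaveOn`** (concave ⇒ OVER-estimates).
* §6 the row's step in numbers (arithmetic only): `flowStep_sq_div_eight` — `(1/20)²/8 = 1/3200` and `(1/50)²/8 = 1/20000`:
  at the protocol's steps the second-order factor `h²/8` is `3.125 × 10⁻⁴` resp. `5 × 10⁻⁵`, to be multiplied by the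
  profile's curvature-to-slope ratio `M/m` on the bracketing step — versus the hypothesis-free first-order `h = 0.05`.

NOT CLAIMED: that a measured profile IS monotone / has the stated slope floor or curvature bound on the bracketing step
(these are properties of the data, checked per reading); any value of `t₀`, `M`, `m`; the RK3 integration error of the
profile itself (row 9's `Scoring/WilsonFlowRK3*`); statistical errors; `w₀` (the same analysis applies verbatim to the
profile `t ↦ t·d(t²E)/dt` once it is formed, and is not restated).
-/

namespace Summit.Ventures.LatticeQCDFlow.Scoring

open Set

/-! ## §1 The crossing on a monotone step exists and is unique -/

/-- **The crossing is well posed on a bracketing monotone step**: for `g` continuous and strictly increasing on `[a, b]`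
with `g a ≤ c ≤ g b` there is exactly one `t₀ ∈ [a, b]` with `g t₀ = c`. -/
theorem flowScale_existsUnique_root {g : ℝ → ℝ} {a b c : ℝ} (hab : a ≤ b) (hg : ContinuousOn g (Icc a b))
    (hmono : StrictMonoOn g (Icc a b)) (hac : g a ≤ c) (hcb : c ≤ g b) :
    ∃! t, t ∈ Icc a b ∧ g t = c := by
  obtain ⟨t, ht, hgt⟩ := intermediate_value_Icc hab hg ⟨hac, hcb⟩
  refine ⟨t, ⟨ht, hgt⟩, fun s ⟨hs, hgs⟩ => ?_⟩
  exact hmono.injOn hs ht (hgs.trans hgt.symm)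

/-- A slope floor `m > 0` on the step makes the profile strictly increasing there (so §1 applies). -/
theorem strictMonoOn_of_slopeFloor {g : ℝ → ℝ} {a b m : ℝ} (hm : 0 < m)
    (hslope : ∀ x ∈ Icc a b, ∀ y ∈ Icc a b, x ≤ y → m * (y - x) ≤ g y - g x) :
    StrictMonoOn g (Icc a b) := by
  intro x hx y hy hxy
  have h := hslope x hx y hy hxy.le
  have : 0 < m * (y - x) := mul_pos hm (sub_pos.2 hxy)
  linarith

/-! ## §2 The interpolated time lies in the step and the chord takes the value `c` there -/

/-- `t⋆ − a = (c − g a)(b − a)/(g b − g a)`. -/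
theorem linInterp_sub_left (g : ℝ → ℝ) (a b c : ℝ) :
    a + (c - g a) * (b - a) / (g b - g a) - a = (c - g a) * (b - a) / (g b - g a) := by
  ring

/-- **`a ≤ t⋆ ≤ b`**: on a bracketing step with `g a < g b` the interpolated time lies in the step. -/
theorem linInterp_mem_Icc {g : ℝ → ℝ} {a b c : ℝ} (hab : a ≤ b) (hac : g a ≤ c) (hcb : c ≤ g b)
    (hgab : g a < g b) :
    a + (c - g a) * (b - a) / (g b - g a) ∈ Icc a b := by
  have hden : 0 < g b - g a := sub_pos.2 hgab
  have hfrac0 : 0 ≤ (c - g a) * (b - a) / (g b - g a) :=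
    div_nonneg (mul_nonneg (sub_nonneg.2 hac) (sub_nonneg.2 hab)) hden.le
  have hfrac1 : (c - g a) * (b - a) / (g b - g a) ≤ b - a := by
    rw [div_le_iff₀ hden]
    have h1 : c - g a ≤ g b - g a := sub_le_sub_right hcb _
    nlinarith [sub_nonneg.2 hab, sub_nonneg.2 hac]
  constructor <;> linarith

/-- **The chord takes the value `c` at `t⋆`** (`a ≠ b`, `g a ≠ g b`). -/
theorem chord_linInterp {g : ℝ → ℝ} {a b : ℝ} (c : ℝ) (hab : a ≠ b) (hgab : g a ≠ g b) :
    g a + (a + (c - g a) * (b - a) / (g b - g a) - a) * ((g b - g a) / (b - a)) = c := by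
  have h1 : b - a ≠ 0 := sub_ne_zero.2 (Ne.symm hab)
  have h2 : g b - g a ≠ 0 := sub_ne_zero.2 (Ne.symm hgab)
  field_simp
  ring

/-- The chord agrees with `g` at both ends of the step. -/
theorem chord_left (g : ℝ → ℝ) (a b : ℝ) : g a + (a - a) * ((g b - g a) / (b - a)) = g a := by ring

/-- The chord agrees with `g` at both ends of the step. -/
theorem chord_right (g : ℝ → ℝ) {a b : ℝ} (hab : a ≠ b) : g a + (b - a) * ((g b - g a) / (b - a)) = g b := by
  have h1 : b - a ≠ 0 := sub_ne_zero.2 (Ne.symm hab)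
  field_simp
  ring

/-- **Exactness on affine profiles**: if `g` is affine on the step with non-zero slope, the interpolated time IS the
crossing: `g t⋆ = c`. -/
theorem linInterp_eq_root_of_affine {a b c p q : ℝ} (hab : a ≠ b) (hp : p ≠ 0) :
    (fun x => p * x + q) (a + (c - (p * a + q)) * (b - a) / ((p * b + q) - (p * a + q))) = c := by
  have h1 : b - a ≠ 0 := sub_ne_zero.2 (Ne.symm hab)
  have h2 : (p * b + q) - (p * a + q) = p * (b - a) := by ring
  simp only [h2]
  field_simp
  ring

/-! ## §3 The worst case and the slope floor -/

/-- Two points of a step are at most a step apart: `|t − t₀| ≤ max (t − a) (b − t) ≤ b − a`. -/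
theorem flowStep_abs_sub_le_max {a b t t₀ : ℝ} (ht : t ∈ Icc a b) (ht₀ : t₀ ∈ Icc a b) :
    |t - t₀| ≤ max (t - a) (b - t) ∧ max (t - a) (b - t) ≤ b - a := by
  obtain ⟨hta, htb⟩ := ht
  obtain ⟨h0a, h0b⟩ := ht₀
  refine ⟨abs_le.2 ⟨?_, ?_⟩, max_le (by linarith) (by linarith)⟩
  · have : t - t₀ ≥ -(b - t) := by linarith
    exact le_trans (neg_le_neg (le_max_right _ _)) this
  · exact le_trans (by linarith) (le_max_left _ _)

/-- **THE WORST CASE, hypothesis-free: `|t⋆ − t₀| ≤ b − a`** — the interpolated time and the crossing both lie in the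
bracketing step, so the reading is never off by more than one flow step `h`. -/
theorem abs_linInterp_sub_root_le_step {g : ℝ → ℝ} {a b c t₀ : ℝ} (hab : a ≤ b) (hac : g a ≤ c) (hcb : c ≤ g b)
    (hgab : g a < g b) (ht₀ : t₀ ∈ Icc a b) :
    |a + (c - g a) * (b - a) / (g b - g a) - t₀| ≤ b - a := by
  obtain ⟨h1, h2⟩ := flowStep_abs_sub_le_max (linInterp_mem_Icc hab hac hcb hgab) ht₀
  exact h1.trans h2

/-- **A SLOPE FLOOR converts an ordinate residual into a time error**: if `m(y − x) ≤ g y − g x` for `x ≤ y` in the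
step (`m > 0`), then for any two times of the step `|t − t₀| ≤ |g t − g t₀|/m`. -/
theorem abs_sub_le_abs_sub_div_of_slopeFloor {g : ℝ → ℝ} {a b m t t₀ : ℝ} (hm : 0 < m)
    (hslope : ∀ x ∈ Icc a b, ∀ y ∈ Icc a b, x ≤ y → m * (y - x) ≤ g y - g x) (ht : t ∈ Icc a b)
    (ht₀ : t₀ ∈ Icc a b) :
    |t - t₀| ≤ |g t - g t₀| / m := by
  rw [le_div_iff₀ hm]
  rcases le_total t₀ t with h | h
  · have hs := hslope t₀ ht₀ t ht h
    rw [abs_of_nonneg (sub_nonneg.2 h)]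
    calc (t - t₀) * m = m * (t - t₀) := mul_comm _ _
      _ ≤ g t - g t₀ := hs
      _ ≤ |g t - g t₀| := le_abs_self _
  · have hs := hslope t ht t₀ ht₀ h
    rw [abs_of_nonpos (sub_nonpos.2 h)]
    calc -(t - t₀) * m = m * (t₀ - t) := by ring
      _ ≤ g t₀ - g t := hs
      _ ≤ |g t - g t₀| := by rw [abs_sub_comm]; exact le_abs_self _

/-- **The error of the reading is the chord error at `t⋆` over the slope**: with a slope floor `m > 0` on the step and
the crossing `g t₀ = c`, `|t⋆ − t₀| ≤ |g t⋆ − chord t⋆|/m` (the chord takes the value `c` at `t⋆`). -/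
theorem abs_linInterp_sub_root_le_residual_div {g : ℝ → ℝ} {a b c m t₀ : ℝ} (hm : 0 < m) (hab : a < b)
    (hslope : ∀ x ∈ Icc a b, ∀ y ∈ Icc a b, x ≤ y → m * (y - x) ≤ g y - g x) (hac : g a ≤ c) (hcb : c ≤ g b)
    (ht₀ : t₀ ∈ Icc a b) (hroot : g t₀ = c) :
    |a + (c - g a) * (b - a) / (g b - g a) - t₀| ≤
      |g (a + (c - g a) * (b - a) / (g b - g a)) -
          (g a + (a + (c - g a) * (b - a) / (g b - g a) - a) * ((g b - g a) / (b - a)))| / m := by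
  have hgab : g a < g b := by
    have h := hslope a (left_mem_Icc.2 hab.le) b (right_mem_Icc.2 hab.le) hab.le
    have : 0 < m * (b - a) := mul_pos hm (sub_pos.2 hab)
    linarith
  have hmem := linInterp_mem_Icc hab.le hac hcb hgab
  have key := abs_sub_le_abs_sub_div_of_slopeFloor hm hslope hmem ht₀
  have e : g a + (a + (c - g a) * (b - a) / (g b - g a) - a) * ((g b - g a) / (b - a)) = c :=
    chord_linInterp c hab.ne hgab.ne
  rw [e]
  rwa [hroot] at key

/-! ## §4 The chord error from a two-sided curvature bound, without derivatives -/

/-- The chord of `x ↦ x²` through `a, b` exceeds `x²` by exactly `(x − a)(b − x)`: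
`(b − x)a² + (x − a)b² = (b − a)(x² + (x − a)(b − x))`. -/
theorem sq_chord_identity (a b x : ℝ) : (b - x) * a ^ 2 + (x - a) * b ^ 2 = (b - a) * (x ^ 2 + (x - a) * (b - x)) := by
  ring

/-- **Convex side: `g x − chord x ≤ (M/2)(x − a)(b − x)`** whenever `x ↦ g x + (M/2)x²` is convex on the step
(the weak form of `g'' ≥ −M`). -/
theorem sub_chord_le_of_convexOn {g : ℝ → ℝ} {a b M x : ℝ} (hab : a < b)
    (hconv : ConvexOn ℝ (Icc a b) (fun y => g y + M / 2 * y ^ 2)) (hx : x ∈ Icc a b) :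
    g x - (g a + (x - a) * ((g b - g a) / (b - a))) ≤ M / 2 * ((x - a) * (b - x)) := by
  obtain ⟨hxa, hxb⟩ := hx
  have hba : 0 < b - a := sub_pos.2 hab
  rcases eq_or_lt_of_le hxa with rfl | hax
  · -- `x = a`: both sides vanish
    have : g a - (g a + (a - a) * ((g b - g a) / (b - a))) = 0 := by ring
    rw [this]; nlinarith
  rcases eq_or_lt_of_le hxb with rfl | hxb'
  · have hne : x - a ≠ 0 := sub_ne_zero.2 (ne_of_gt hax)
    have : g x - (g a + (x - a) * ((g x - g a) / (x - a))) = 0 := by field_simp; ring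
    rw [this]; nlinarith
  -- interior point: the chord inequality for the convex function `g + (M/2)·sq`
  have key := hconv.secant_mono_aux1 (x := a) (y := x) (z := b) (left_mem_Icc.2 hab.le) (right_mem_Icc.2 hab.le) hax hxb'
  -- `(b − a)(g x + M/2 x²) ≤ (b − x)(g a + M/2 a²) + (x − a)(g b + M/2 b²)`
  have hsq := sq_chord_identity a b x
  have hmul : (b - a) * (g x - (g a + (x - a) * ((g b - g a) / (b - a)))) ≤ (b - a) * (M / 2 * ((x - a) * (b - x))) := by
    have e1 : (b - a) * (g x - (g a + (x - a) * ((g b - g a) / (b - a)))) =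
        (b - a) * g x - ((b - x) * g a + (x - a) * g b) := by
      field_simp; ring
    rw [e1]
    nlinarith [key, hsq]
  exact le_of_mul_le_mul_left hmul hba

/-- **Concave side: `chord x − g x ≤ (M/2)(x − a)(b − x)`** whenever `x ↦ g x − (M/2)x²` is concave on the step
(the weak form of `g'' ≤ M`). -/
theorem chord_sub_le_of_concaveOn {g : ℝ → ℝ} {a b M x : ℝ} (hab : a < b)
    (hconc : ConcaveOn ℝ (Icc a b) (fun y => g y - M / 2 * y ^ 2)) (hx : x ∈ Icc a b) :
    (g a + (x - a) * ((g b - g a) / (b - a))) - g x ≤ M / 2 * ((x - a) * (b - x)) := by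
  have hconv : ConvexOn ℝ (Icc a b) (fun y => (fun z => -g z) y + M / 2 * y ^ 2) := by
    have h := hconc.neg
    refine h.congr fun y _ => ?_
    simp only [Pi.neg_apply]
    ring
  have key := sub_chord_le_of_convexOn (g := fun z => -g z) hab hconv hx
  have e : (fun z => -g z) x - ((fun z => -g z) a + (x - a) * (((fun z => -g z) b - (fun z => -g z) a) / (b - a))) =
      (g a + (x - a) * ((g b - g a) / (b - a))) - g x := by
    simp only
    have : (-g b - -g a) / (b - a) = -((g b - g a) / (b - a)) := by ring
    rw [this]; ring
  rwa [e] at key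

/-- `(x − a)(b − x) ≤ (b − a)²/4` (the parabola peaks at the midpoint). -/
theorem mul_sub_mul_sub_le_sq_div_four (a b x : ℝ) : (x - a) * (b - x) ≤ (b - a) ^ 2 / 4 := by
  nlinarith [sq_nonneg (2 * x - a - b)]

/-- **THE CHORD ERROR: `|g x − chord x| ≤ M(b − a)²/8`** on the step, under the two-sided weak curvature hypothesis
(`g + (M/2)·sq` convex and `g − (M/2)·sq` concave on `[a, b]`, `M ≥ 0`) — the classical `‖g''‖∞h²/8` without
differentiability. -/
theorem abs_sub_chord_le {g : ℝ → ℝ} {a b M x : ℝ} (hab : a < b) (hM : 0 ≤ M)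
    (hconv : ConvexOn ℝ (Icc a b) (fun y => g y + M / 2 * y ^ 2))
    (hconc : ConcaveOn ℝ (Icc a b) (fun y => g y - M / 2 * y ^ 2)) (hx : x ∈ Icc a b) :
    |g x - (g a + (x - a) * ((g b - g a) / (b - a)))| ≤ M * (b - a) ^ 2 / 8 := by
  have h1 := sub_chord_le_of_convexOn hab hconv hx
  have h2 := chord_sub_le_of_concaveOn hab hconc hx
  have h3 : M / 2 * ((x - a) * (b - x)) ≤ M * (b - a) ^ 2 / 8 := by
    have := mul_sub_mul_sub_le_sq_div_four a b x
    nlinarith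
  rw [abs_le]
  constructor <;> linarith

/-! ## §5 The bound, and the one-sided certificates -/

/-- **THE BOUND — SECOND ORDER IN THE FLOW STEP: `|t⋆ − t₀| ≤ M(b − a)²/(8m)`** for a profile with slope floor `m > 0`
and two-sided weak curvature `M ≥ 0` on the bracketing step `[a, b]`, `g a ≤ c ≤ g b`, `g t₀ = c`, `t₀ ∈ [a, b]`. -/
theorem abs_linInterp_sub_root_le_of_curvature {g : ℝ → ℝ} {a b c m M t₀ : ℝ} (hm : 0 < m) (hM : 0 ≤ M) (hab : a < b)
    (hslope : ∀ x ∈ Icc a b, ∀ y ∈ Icc a b, x ≤ y → m * (y - x) ≤ g y - g x)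
    (hconv : ConvexOn ℝ (Icc a b) (fun y => g y + M / 2 * y ^ 2))
    (hconc : ConcaveOn ℝ (Icc a b) (fun y => g y - M / 2 * y ^ 2)) (hac : g a ≤ c) (hcb : c ≤ g b)
    (ht₀ : t₀ ∈ Icc a b) (hroot : g t₀ = c) :
    |a + (c - g a) * (b - a) / (g b - g a) - t₀| ≤ M * (b - a) ^ 2 / (8 * m) := by
  have hgab : g a < g b := by
    have h := hslope a (left_mem_Icc.2 hab.le) b (right_mem_Icc.2 hab.le) hab.le
    have : 0 < m * (b - a) := mul_pos hm (sub_pos.2 hab)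
    linarith
  have hmem := linInterp_mem_Icc hab.le hac hcb hgab
  have h1 := abs_linInterp_sub_root_le_residual_div hm hab hslope hac hcb ht₀ hroot
  have h2 := abs_sub_chord_le hab hM hconv hconc hmem
  calc |a + (c - g a) * (b - a) / (g b - g a) - t₀|
      ≤ |g (a + (c - g a) * (b - a) / (g b - g a)) -
          (g a + (a + (c - g a) * (b - a) / (g b - g a) - a) * ((g b - g a) / (b - a)))| / m := h1
    _ ≤ (M * (b - a) ^ 2 / 8) / m := div_le_div_of_nonneg_right h2 hm.le
    _ = M * (b - a) ^ 2 / (8 * m) := by rw [div_div]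

/-- The chord is increasing in `x` when `g a < g b` and `a < b`. -/
theorem chord_le_chord {g : ℝ → ℝ} {a b x y : ℝ} (hab : a < b) (hgab : g a ≤ g b) (hxy : x ≤ y) :
    g a + (x - a) * ((g b - g a) / (b - a)) ≤ g a + (y - a) * ((g b - g a) / (b - a)) := by
  have hs : 0 ≤ (g b - g a) / (b - a) := div_nonneg (sub_nonneg.2 hgab) (sub_pos.2 hab).le
  nlinarith [mul_le_mul_of_nonneg_right (sub_le_sub_right hxy a) hs]

/-- **CONVEX INCREASING PROFILE ⇒ THE READING UNDER-ESTIMATES: `t⋆ ≤ t₀`.**  (The chord lies above a convex `g`, so it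
reaches the level `c` no later than `g` does.) -/
theorem linInterp_le_root_of_convexOn {g : ℝ → ℝ} {a b c t₀ : ℝ} (hab : a < b) (hconv : ConvexOn ℝ (Icc a b) g)
    (hgab : g a < g b) (ht₀ : t₀ ∈ Icc a b) (hroot : g t₀ = c) :
    a + (c - g a) * (b - a) / (g b - g a) ≤ t₀ := by
  -- chord ≥ g at t₀
  have hconv' : ConvexOn ℝ (Icc a b) (fun y => g y + 0 / 2 * y ^ 2) :=
    hconv.congr fun y _ => by ring
  have h1 := sub_chord_le_of_convexOn hab hconv' ht₀
  have hchord : c ≤ g a + (t₀ - a) * ((g b - g a) / (b - a)) := by rw [← hroot]; linarith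
  -- solve the affine inequality for t₀
  have hden : 0 < g b - g a := sub_pos.2 hgab
  have hba : 0 < b - a := sub_pos.2 hab
  have h2 : (c - g a) * (b - a) ≤ (t₀ - a) * (g b - g a) := by
    have := mul_le_mul_of_nonneg_right (sub_le_iff_le_add'.2 hchord : c - g a ≤ (t₀ - a) * ((g b - g a) / (b - a)))
      hba.le
    rwa [mul_assoc, div_mul_cancel₀ _ hba.ne'] at this
  have h3 : (c - g a) * (b - a) / (g b - g a) ≤ t₀ - a := by
    rw [div_le_iff₀ hden]; exact h2
  linarith

/-- **CONCAVE INCREASING PROFILE ⇒ THE READING OVER-ESTIMATES: `t₀ ≤ t⋆`.** -/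
theorem root_le_linInterp_of_concaveOn {g : ℝ → ℝ} {a b c t₀ : ℝ} (hab : a < b) (hconc : ConcaveOn ℝ (Icc a b) g)
    (hgab : g a < g b) (ht₀ : t₀ ∈ Icc a b) (hroot : g t₀ = c) :
    t₀ ≤ a + (c - g a) * (b - a) / (g b - g a) := by
  have hconc' : ConcaveOn ℝ (Icc a b) (fun y => g y - 0 / 2 * y ^ 2) :=
    hconc.congr fun y _ => by ring
  have h1 := chord_sub_le_of_concaveOn hab hconc' ht₀
  have hchord : g a + (t₀ - a) * ((g b - g a) / (b - a)) ≤ c := by rw [← hroot]; linarith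
  have hden : 0 < g b - g a := sub_pos.2 hgab
  have hba : 0 < b - a := sub_pos.2 hab
  have h2 : (t₀ - a) * (g b - g a) ≤ (c - g a) * (b - a) := by
    have h' : (t₀ - a) * ((g b - g a) / (b - a)) ≤ c - g a := by linarith
    have := mul_le_mul_of_nonneg_right h' hba.le
    rwa [mul_assoc, div_mul_cancel₀ _ hba.ne'] at this
  have h3 : t₀ - a ≤ (c - g a) * (b - a) / (g b - g a) := by
    rw [le_div_iff₀ hden]; exact h2
  linarith

/-! ## §6 The protocol's steps, arithmetic only -/

/-- The second-order factor `h²/8` at the protocol's two flow steps: `h = 1/20` (`t > 1`) gives `1/3200 = 3.125·10⁻⁴`,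
`h = 1/50` (`t ≤ 1`) gives `1/20000 = 5·10⁻⁵` — to be multiplied by the profile's `M/m` on the bracketing step
(`abs_linInterp_sub_root_le_of_curvature`); the hypothesis-free bound (`abs_linInterp_sub_root_le_step`) is `h` itself. -/
theorem flowStep_sq_div_eight :
    ((1 : ℝ) / 20) ^ 2 / 8 = 1 / 3200 ∧ ((1 : ℝ) / 50) ^ 2 / 8 = 1 / 20000 := by
  constructor <;> norm_num

/-- With the bound of §5 in the form `(M/m)·h²/8`: at `h = 1/20` the reading's error is at most `(M/m)/3200`. -/
theorem abs_linInterp_sub_root_le_protocolStep {g : ℝ → ℝ} {a c m M t₀ : ℝ} (hm : 0 < m) (hM : 0 ≤ M)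
    (hslope : ∀ x ∈ Icc a (a + 1 / 20), ∀ y ∈ Icc a (a + 1 / 20), x ≤ y → m * (y - x) ≤ g y - g x)
    (hconv : ConvexOn ℝ (Icc a (a + 1 / 20)) (fun y => g y + M / 2 * y ^ 2))
    (hconc : ConcaveOn ℝ (Icc a (a + 1 / 20)) (fun y => g y - M / 2 * y ^ 2)) (hac : g a ≤ c) (hcb : c ≤ g (a + 1 / 20))
    (ht₀ : t₀ ∈ Icc a (a + 1 / 20)) (hroot : g t₀ = c) :
    |a + (c - g a) * (a + 1 / 20 - a) / (g (a + 1 / 20) - g a) - t₀| ≤ M / m / 3200 := by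
  have hab : a < a + 1 / 20 := by linarith
  have h := abs_linInterp_sub_root_le_of_curvature hm hM hab hslope hconv hconc hac hcb ht₀ hroot
  have e : M * (a + 1 / 20 - a) ^ 2 / (8 * m) = M / m / 3200 := by
    field_simp
    ring
  rwa [e] at h

end Summit.Ventures.LatticeQCDFlow.Scoring
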